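import Mathlib.Topology.MetricSpace.Pseudo.Defs
import Mathlib.Data.Finset.Max
import Mathlib.Data.Nat.Log
import HarnessLib

/-!
# The annular covering lemma of Aizenman–Duminil-Copin (2021), Lemma 4.2

Topic `Literature/Probability/LatticeModels`. A deterministic combinatorial lemma used in the proof
of the improved tree diagram bound for the four-dimensional Ising model (the tree's named fact
`aizenmanDuminilCopin_improvedTreeDiagramBound`, `ImprovedTreeDiagramBound.lean`):

* M. Aizenman, H. Duminil-Copin, *Marginal triviality of the scaling limits of critical 4D Ising
  and `φ⁴₄` models*, Ann. of Math. **194** (2021) 163–235, arXiv:1912.07973, **Lemma 4.2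
  (Annular covering)** (§4.1), bib key `AizenmanDuminilCopinAnnals2021` ("ADC"):

  "for any (possibly finite) increasing sequence of lengths `𝓛 = (ℓ_k)`, every `u ∈ ℤ^d` and every
  integer `K`, `M_u(𝒳; 𝓛, K) = card{k ≤ K : 𝒳 ∩ [u + Ann(ℓ_k, ℓ_{k+1})] ≠ ∅}` … for any sequence
  `𝓛 = (ℓ_k)` with `ℓ_1 ≥ 1` and `ℓ_{k+1} ≥ 2ℓ_k`, `|𝒳| ≥ 2^{min{M_u(𝒳;𝓛,K)/5 : u ∈ 𝒳}}`",

  with `Ann(k,n) = Λ_n ∖ Λ_{k-1} = {k ≤ |x| ≤ n}` in the sup norm. It links the number of points of a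
  finite set `𝒳` to the number of concentric annuli `u + Ann(ℓ_k, ℓ_{k+1})`, centred at a point `u`
  of `𝒳`, that `𝒳` meets; its only uses (ADC, proof of Thm 1.3 in §4.1 — the bound on
  `P[0 < |𝒯| < 2^{δK/5}]` — and §6.1; R. Panis, arXiv:2309.05797, §6) are in the covering form "if
  `0 < |𝒳| < 2^r` then some
  `u ∈ 𝒳` has `M_u(𝒳; 𝓛, K) < C r`", where the value of the absolute constant `C` is immaterial
  (it is absorbed in the `δ` of the intersection-clustering bound, ADC Prop. 4.3 / Prop. 6.1).

## What is proved, and a remark on the printed constant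

The lemma is purely metric (only the triangle inequality is used), so it is stated for a finite
set `X` in a pseudo-metric space `α` (`ℤ^d = Site d` with `dist x y = ‖x - y‖_∞` is the case of
the paper), a scale sequence `ℓ : ℕ → ℕ` with `1 ≤ ℓ 1` and `2 ℓ k ≤ ℓ (k+1)` (as printed; `ℓ 0`
may be `0`, as in ADC §6.1), and

  `annulusCount ℓ K X u = M_u(X; ℓ, K) = #{k ≤ K : ∃ x ∈ X, ℓ_k ≤ dist u x ≤ ℓ_{k+1}}`.

ADC prove the lemma through the "stronger statement" `|𝒳 ∩ Λ_{ℓ_K}| < 2^r ⇒ ∃ u ∈ 𝒳 ∩ Λ_{ℓ_K},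
M_u(𝒳; 𝓛, K) < 5r` (for `𝒳 ∋ 0`), by induction on `r`: pick the outermost occupied annulus
`k ≤ K - 2` around the centre and a point `u` in it, observe that `𝒳 ∩ Λ_{ℓ_{k-1}}` and
`𝒳 ∩ (u + Λ_{ℓ_{k-1}})` are disjoint so that one of them has `< 2^{r-1}` points, apply the
induction hypothesis inside that box to get `v`, and count the annuli around `v` of index `≥ k`
that can still be occupied. In the first case these are `k, k+1, K-2, K-1, K` (five, as printed).
In the second case ("simply translate the set by `u` and apply the same reasoning"), however, `v`
lies at distance up to `ℓ_{k+1} + ℓ_{k-1}` from the centre, and under the printed growth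
`ℓ_{k+1} ≥ 2ℓ_k` the same count gives the indices `k, k+1, k+2` and `K-3, K-2, K-1, K` — up to
seven. We therefore prove the printed induction with the constant the printed argument actually
yields under the printed hypotheses:

* `exists_annulusCount_lt_of_card_lt_two_pow` — `1 ≤ ℓ 1`, `2ℓ_k ≤ ℓ_{k+1}`, `X ≠ ∅`, `|X| < 2^r`
  `⇒ ∃ u ∈ X, M_u(X; ℓ, K) < 7r` (the covering form used in the proof of ADC Thm 1.3 and in §6.1;
  it is also the form in which the June 2020 preprint states the lemma, there numbered Lemma 3.2);
* `exists_two_pow_annulusCount_div_le_card` — the printed shape `|X| ≥ 2^{⌊M_u(X;ℓ,K)/7⌋}` for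
  some `u ∈ X` (i.e. `|X| ≥ 2^{min_u ⌊M_u/7⌋}`).

(With `ℓ_{k+1} ≥ 4ℓ_k` the same proof gives the constant `5`; every application has
`ℓ_{k+1} ≥ ℓ_k^α` with `α` large, and any constant.) No named fact is introduced; everything here
is proved.

## References

* [ADC] M. Aizenman, H. Duminil-Copin, Ann. of Math. 194 (2021), arXiv:1912.07973, §4.1,
  Lemma 4.2 and its proof (Lemma 3.2 of the June 2020 preprint, www.ihes.fr/~duminil); uses: proof
  of Thm 1.3 in §4.1, Prop. 4.3, Prop. 6.1.
* R. Panis, *Triviality of the scaling limits of critical Ising and φ⁴ models with effective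
  dimension at least four*, arXiv:2309.05797 (2023), §6 (same lemma) [Panis2023Triviality].
-/

noncomputable section

open Finset

namespace Literature.Probability.LatticeModels

variable {α : Type*} [PseudoMetricSpace α]

/-! ### The annulus count `M_u(X; ℓ, K)` -/

/-- The annulus `u + Ann(ℓ_k, ℓ_{k+1})` around `u` **is occupied** by the finite set `X`:
some `x ∈ X` has `ℓ_k ≤ dist u x ≤ ℓ_{k+1}` (Aizenman–Duminil-Copin 2021, §4.1, the condition
"`𝒳 ∩ [u + Ann(ℓ_k, ℓ_{k+1})] ≠ ∅`" in the definition of `M_u`; consecutive closed annuli share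
their boundary sphere, as printed: `Ann(k,n) = Λ_n ∖ Λ_{k-1}`).
[cite: AizenmanDuminilCopinAnnals2021, arXiv:1912.07973 §4.1, definition of M_u before Lemma 4.2] -/
def AnnulusOccupied (ℓ : ℕ → ℕ) (X : Finset α) (u : α) (k : ℕ) : Prop :=
  ∃ x ∈ X, (ℓ k : ℝ) ≤ dist u x ∧ dist u x ≤ ℓ (k + 1)

open scoped Classical in
/-- **The annulus count** `M_u(X; ℓ, K) = card{k ≤ K : X ∩ [u + Ann(ℓ_k, ℓ_{k+1})] ≠ ∅}` of
Aizenman–Duminil-Copin 2021, §4.1: the number of indices `k ∈ {0, …, K}` whose annulus around `u`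
is occupied by `X`. [cite: AizenmanDuminilCopinAnnals2021, arXiv:1912.07973 §4.1, definition of M_u before Lemma 4.2] -/
def annulusCount (ℓ : ℕ → ℕ) (K : ℕ) (X : Finset α) (u : α) : ℕ :=
  #((range (K + 1)).filter (AnnulusOccupied ℓ X u))

/-- `M_u(X; ℓ, K) ≤ K + 1`. [folklore] -/
theorem annulusCount_le (ℓ : ℕ → ℕ) (K : ℕ) (X : Finset α) (u : α) :
    annulusCount ℓ K X u ≤ K + 1 := by
  classical
  unfold annulusCount
  exact (card_filter_le _ _).trans (card_range _).le

/-- If every occupied annulus of index `≤ K` around `u` has its index in `S`, then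
`M_u(X; ℓ, K) ≤ |S|`. [folklore] -/
theorem annulusCount_le_card {ℓ : ℕ → ℕ} {K : ℕ} {X : Finset α} {u : α} (S : Finset ℕ)
    (h : ∀ k, k ≤ K → AnnulusOccupied ℓ X u k → k ∈ S) : annulusCount ℓ K X u ≤ #S := by
  classical
  unfold annulusCount
  refine card_le_card fun k hk => ?_
  rw [mem_filter, mem_range] at hk
  exact h k (Nat.lt_succ_iff.1 hk.1) hk.2

/-- Splitting the count at an intermediate index `K' ≤ K`: the annuli of index `≤ K'`, plus the
occupied ones with index in `(K', K]`, the latter being bounded by `|S|` as soon as their indices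
lie in `S`. [folklore] -/
theorem annulusCount_le_add_card {ℓ : ℕ → ℕ} {K' K : ℕ} {X : Finset α} {u : α} (S : Finset ℕ)
    (h : ∀ j, K' < j → j ≤ K → AnnulusOccupied ℓ X u j → j ∈ S) :
    annulusCount ℓ K X u ≤ annulusCount ℓ K' X u + #S := by
  classical
  unfold annulusCount
  calc #((range (K + 1)).filter (AnnulusOccupied ℓ X u))
      ≤ #((range (K' + 1)).filter (AnnulusOccupied ℓ X u) ∪ S) := by
        refine card_le_card fun k hk => ?_
        rw [mem_filter, mem_range] at hk
        rw [mem_union, mem_filter, mem_range]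
        by_cases hkK' : k ≤ K'
        · exact Or.inl ⟨Nat.lt_succ_iff.2 hkK', hk.2⟩
        · exact Or.inr (h k (not_le.1 hkK') (Nat.lt_succ_iff.1 hk.1) hk.2)
    _ ≤ _ := card_union_le _ _

/-! ### Doubling scale sequences -/

/-- A scale sequence with `ℓ_1 ≥ 1` and `ℓ_{k+1} ≥ 2ℓ_k` has `ℓ_k ≥ 1` for `k ≥ 1`. [folklore] -/
theorem one_le_scale {ℓ : ℕ → ℕ} (h1 : 1 ≤ ℓ 1) (h2 : ∀ k, 2 * ℓ k ≤ ℓ (k + 1)) {k : ℕ}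
    (hk : 1 ≤ k) : 1 ≤ ℓ k := by
  induction k with
  | zero => exact absurd hk (by omega)
  | succ n ih =>
    rcases Nat.eq_zero_or_pos n with rfl | hn
    · exact h1
    · have := h2 n
      have := ih hn
      omega

/-- A scale sequence with `ℓ_1 ≥ 1` and `ℓ_{k+1} ≥ 2ℓ_k` is strictly increasing. [folklore] -/
theorem scale_strictMono {ℓ : ℕ → ℕ} (h1 : 1 ≤ ℓ 1) (h2 : ∀ k, 2 * ℓ k ≤ ℓ (k + 1)) :
    StrictMono ℓ := by
  refine strictMono_nat_of_lt_succ fun k => ?_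
  rcases Nat.eq_zero_or_pos k with rfl | hk
  · have h := h2 0
    simp only [Nat.zero_add] at h ⊢
    omega
  · have := h2 k
    have := one_le_scale h1 h2 hk
    omega

/-- Locating a length between two scales: if `ℓ_a < t ≤ ℓ_b` then `ℓ_j < t ≤ ℓ_{j+1}` for some
`a ≤ j < b`. [folklore] -/
theorem exists_scale_lt_and_le {ℓ : ℕ → ℕ} (hℓ : StrictMono ℓ) {a : ℕ} {t : ℝ}
    (ha : (ℓ a : ℝ) < t) : ∀ (b : ℕ), t ≤ ℓ b → ∃ j, a ≤ j ∧ j < b ∧ (ℓ j : ℝ) < t ∧ t ≤ ℓ (j + 1)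
  | 0, hb => by
    exfalso
    have : (ℓ 0 : ℝ) ≤ ℓ a := by exact_mod_cast hℓ.monotone (Nat.zero_le a)
    linarith
  | b + 1, hb => by
    by_cases h : t ≤ ℓ b
    · obtain ⟨j, haj, hjb, hj, hj'⟩ := exists_scale_lt_and_le hℓ ha b h
      exact ⟨j, haj, Nat.lt_succ_of_lt hjb, hj, hj'⟩
    · refine ⟨b, ?_, Nat.lt_succ_self b, not_le.1 h, hb⟩
      by_contra hab
      have : (ℓ (b + 1) : ℝ) ≤ ℓ a := by exact_mod_cast hℓ.monotone (by omega)
      linarith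

/-! ### The induction of Aizenman–Duminil-Copin -/

/-- **The inductive statement behind the annular covering lemma** (Aizenman–Duminil-Copin 2021,
proof of Lemma 4.2, "the following stronger statement", with the constant the printed induction
yields under `ℓ_{k+1} ≥ 2ℓ_k`, see the module docstring): for `r ≥ 1`, every `K`, every finite
`X` and every `x₀ ∈ X`, if fewer than `2^r` points of `X` lie within distance `ℓ_K` of `x₀`, then
some `u ∈ X` within distance `ℓ_K` of `x₀` has `M_u(X; ℓ, K) < 7r`.
[cite: AizenmanDuminilCopinAnnals2021, arXiv:1912.07973 §4.1, Lemma 4.2, proof] -/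
theorem exists_annulusCount_lt_aux {ℓ : ℕ → ℕ} (h1 : 1 ≤ ℓ 1) (h2 : ∀ k, 2 * ℓ k ≤ ℓ (k + 1))
    {r : ℕ} (hr : 1 ≤ r) :
    ∀ (K : ℕ) (X : Finset α) (x₀ : α), x₀ ∈ X →
      #(X.filter fun x => dist x₀ x ≤ ℓ K) < 2 ^ r →
      ∃ u ∈ X, dist x₀ u ≤ ℓ K ∧ annulusCount ℓ K X u < 7 * r := by
  classical
  have hmono := scale_strictMono h1 h2
  -- real-valued forms of the scale inequalities
  have cast_le : ∀ {i j : ℕ}, i ≤ j → (ℓ i : ℝ) ≤ ℓ j := fun h => by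
    exact_mod_cast hmono.monotone h
  have cast_lt_imp : ∀ {i j : ℕ}, (ℓ i : ℝ) < ℓ j → i < j := fun h => by
    exact hmono.lt_iff_lt.1 (by exact_mod_cast h)
  have cast_two : ∀ i : ℕ, (ℓ i : ℝ) + ℓ i ≤ ℓ (i + 1) := fun i => by
    have := h2 i
    exact_mod_cast (show ℓ i + ℓ i ≤ ℓ (i + 1) by omega)
  induction r, hr using Nat.le_induction with
  | base =>
    intro K X x₀ hx₀ hcard
    refine ⟨x₀, hx₀, by simp, ?_⟩
    -- fewer than two points within `ℓ_K`: only `x₀` itself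
    rw [pow_one] at hcard
    have honly : ∀ x ∈ X, dist x₀ x ≤ ℓ K → x = x₀ := by
      intro x hx hxd
      have hle : #(X.filter fun x => dist x₀ x ≤ ℓ K) ≤ 1 := by omega
      rw [card_le_one] at hle
      exact hle x (mem_filter.2 ⟨hx, hxd⟩) x₀ (mem_filter.2 ⟨hx₀, by simp⟩)
    calc annulusCount ℓ K X x₀ ≤ #({0, K} : Finset ℕ) := by
          refine annulusCount_le_card _ fun k hk ⟨x, hx, hkx, hxk⟩ => ?_
          rw [mem_insert, mem_singleton]
          by_cases hxd : dist x₀ x ≤ ℓ K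
          · -- `x = x₀`, so `ℓ_k ≤ 0`, forcing `k = 0`
            left
            rw [honly x hx hxd, dist_self] at hkx
            by_contra hk0
            have := one_le_scale h1 h2 (Nat.one_le_iff_ne_zero.2 hk0)
            have : (1 : ℝ) ≤ ℓ k := by exact_mod_cast this
            linarith
          · -- `dist x₀ x > ℓ_K` forces `k + 1 > K`
            right
            have : K < k + 1 := cast_lt_imp (lt_of_lt_of_le (lt_of_not_ge hxd) hxk)
            omega
      _ ≤ 2 := card_le_two
      _ < 7 * 1 := by norm_num
  | succ r _ ih =>
    intro K X x₀ hx₀ hcard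
    -- small `K`: the count is at most `K + 1`
    by_cases hK : K ≤ 5
    · refine ⟨x₀, hx₀, by simp, ?_⟩
      have := annulusCount_le ℓ K X x₀
      omega
    -- the points of `X` at distance in `(ℓ_0, ℓ_{K-1}]` from `x₀`
    set Mid : Finset α := X.filter fun x => (ℓ 0 : ℝ) < dist x₀ x ∧ dist x₀ x ≤ ℓ (K - 1)
      with hMid
    rcases Mid.eq_empty_or_nonempty with hMe | hMne
    · -- no such point: only the annuli `0`, `K - 1`, `K` around `x₀` can be occupied
      refine ⟨x₀, hx₀, by simp, ?_⟩
      calc annulusCount ℓ K X x₀ ≤ #({0, K - 1, K} : Finset ℕ) := by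
            refine annulusCount_le_card _ fun k hk ⟨x, hx, hkx, hxk⟩ => ?_
            simp only [mem_insert, mem_singleton]
            by_cases h0 : dist x₀ x ≤ ℓ 0
            · left
              have h01 : (ℓ 0 : ℝ) < ℓ 1 := by exact_mod_cast hmono Nat.zero_lt_one
              have : k < 1 := cast_lt_imp (lt_of_le_of_lt (hkx.trans h0) h01)
              omega
            · right
              have hfar : (ℓ (K - 1) : ℝ) < dist x₀ x := by
                by_contra hle
                have : x ∈ Mid := by
                  rw [hMid, mem_filter]
                  exact ⟨hx, lt_of_not_ge h0, le_of_not_gt hle⟩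
                rw [hMe] at this
                exact notMem_empty x this
              have : K - 1 < k + 1 := cast_lt_imp (hfar.trans_le hxk)
              omega
        _ ≤ 3 := card_le_three
        _ < 7 * (r + 1) := by omega
    · -- the outermost such point `u`, at distance `t ∈ (ℓ_k, ℓ_{k+1}]`, `k ≤ K - 2`
      obtain ⟨u, huMid, humax⟩ := exists_max_image Mid (fun x => dist x₀ x) hMne
      have huX : u ∈ X := (mem_filter.1 huMid).1
      have hu0 : (ℓ 0 : ℝ) < dist x₀ u := (mem_filter.1 huMid).2.1
      have huK : dist x₀ u ≤ ℓ (K - 1) := (mem_filter.1 huMid).2.2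
      obtain ⟨k, -, hkK, hku, huk⟩ := exists_scale_lt_and_le hmono hu0 (K - 1) huK
      -- every point of `X` is either within `ℓ_{k+1}` of `x₀` or beyond `ℓ_{K-1}`
      have dich : ∀ x ∈ X, dist x₀ x ≤ ℓ (k + 1) ∨ (ℓ (K - 1) : ℝ) < dist x₀ x := by
        intro x hx
        by_cases hfar : (ℓ (K - 1) : ℝ) < dist x₀ x
        · exact Or.inr hfar
        · left
          by_cases h0 : dist x₀ x ≤ ℓ 0
          · exact h0.trans (cast_le (Nat.zero_le _))
          · have hxMid : x ∈ Mid := by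
              rw [hMid, mem_filter]
              exact ⟨hx, lt_of_not_ge h0, le_of_not_gt hfar⟩
            exact (humax x hxMid).trans huk
      rcases Nat.eq_zero_or_pos k with rfl | hkpos
      · -- `k = 0`: around `x₀` only the annuli `0, 1, K-1, K` can be occupied
        refine ⟨x₀, hx₀, by simp, ?_⟩
        calc annulusCount ℓ K X x₀ ≤ #({0, 1, K - 1, K} : Finset ℕ) := by
              refine annulusCount_le_card _ fun j hj ⟨x, hx, hjx, hxj⟩ => ?_
              simp only [mem_insert, mem_singleton]
              rcases dich x hx with hin | hout
              · have h12 : (ℓ (0 + 1) : ℝ) < ℓ (0 + 1 + 1) := by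
                  exact_mod_cast hmono (show 0 + 1 < 0 + 1 + 1 by norm_num)
                have : j < 0 + 1 + 1 := cast_lt_imp (lt_of_le_of_lt (hjx.trans hin) h12)
                omega
              · have : K - 1 < j + 1 := cast_lt_imp (hout.trans_le hxj)
                omega
          _ ≤ 4 := card_le_four
          _ < 7 * (r + 1) := by omega
      · -- `k ≥ 1`: the two disjoint small boxes of radius `ℓ_{k-1}` around `x₀` and `u`
        obtain ⟨k, rfl⟩ : ∃ k', k = k' + 1 := ⟨k - 1, by omega⟩
        have e2 : k + 1 + 1 = k + 2 := rfl
        rw [e2] at huk dich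
        set P : Finset α := X.filter fun x => dist x₀ x ≤ ℓ k with hP
        set Q : Finset α := X.filter fun x => dist u x ≤ ℓ k with hQ
        -- scale facts
        have hk2 : (ℓ k : ℝ) + ℓ k ≤ ℓ (k + 1) := cast_two k
        have hkk2 : (ℓ k : ℝ) < ℓ (k + 2) := by exact_mod_cast hmono (by omega : k < k + 2)
        have hk2K1 : (ℓ (k + 2) : ℝ) ≤ ℓ (K - 1) := cast_le (by omega)
        have hK1K : (ℓ (K - 1) : ℝ) + ℓ (K - 1) ≤ ℓ K := by
          have := cast_two (K - 1)
          rwa [show K - 1 + 1 = K by omega] at this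
        have huv_far : ∀ {v : α}, dist u v ≤ ℓ k → dist x₀ v ≤ ℓ K := fun {v} hv =>
          calc dist x₀ v ≤ dist x₀ u + dist u v := dist_triangle _ _ _
            _ ≤ ℓ (k + 2) + ℓ k := add_le_add huk hv
            _ ≤ ℓ K := by linarith
        have hdisj : Disjoint P Q := by
          rw [Finset.disjoint_left]
          intro x hxP hxQ
          have h1' : dist x₀ x ≤ ℓ k := (mem_filter.1 hxP).2
          have h2' : dist u x ≤ ℓ k := (mem_filter.1 hxQ).2
          have := dist_triangle x₀ x u
          rw [dist_comm x u] at this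
          linarith
        have hPQ : P ∪ Q ⊆ X.filter fun x => dist x₀ x ≤ ℓ K := by
          intro x hx
          rw [mem_union] at hx
          rw [mem_filter]
          rcases hx with hx | hx
          · have hx' := mem_filter.1 hx
            exact ⟨hx'.1, hx'.2.trans (cast_le (by omega))⟩
          · have hx' := mem_filter.1 hx
            exact ⟨hx'.1, huv_far hx'.2⟩
        have hsum : #P + #Q < 2 ^ r + 2 ^ r := by
          rw [← card_union_of_disjoint hdisj, ← two_mul, ← pow_succ']
          exact (card_le_card hPQ).trans_lt hcard
        by_cases hPsmall : #P < 2 ^ r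
        · -- Case A: induction inside the box around `x₀`
          rw [hP] at hPsmall
          obtain ⟨v, hvX, hv, hcount⟩ := ih k X x₀ hx₀ hPsmall
          refine ⟨v, hvX, hv.trans (cast_le (by omega)), ?_⟩
          have hext : ∀ j, k < j → j ≤ K → AnnulusOccupied ℓ X v j →
              j ∈ ({k + 1, k + 2, K - 2, K - 1, K} : Finset ℕ) := by
            rintro j hkj hjK ⟨x, hx, hjx, hxj⟩
            simp only [mem_insert, mem_singleton]
            rcases dich x hx with hin | hout
            · -- inner point: `dist v x < ℓ_{k+3}`, so `j ≤ k + 2`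
              have h3 : (ℓ (k + 2) : ℝ) + ℓ (k + 2) ≤ ℓ (k + 3) := cast_two (k + 2)
              have : dist v x < ℓ (k + 3) :=
                calc dist v x ≤ dist v x₀ + dist x₀ x := dist_triangle _ _ _
                  _ ≤ ℓ k + ℓ (k + 2) := by rw [dist_comm]; exact add_le_add hv hin
                  _ < ℓ (k + 3) := by linarith
              have : j < k + 3 := cast_lt_imp (hjx.trans_lt this)
              omega
            · -- outer point: `dist v x > ℓ_{K-2}`, so `j ≥ K - 2`
              have hK2 : (ℓ (K - 2) : ℝ) + ℓ (K - 2) ≤ ℓ (K - 1) := by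
                have := cast_two (K - 2)
                rwa [show K - 2 + 1 = K - 1 by omega] at this
              have hkK2 : (ℓ k : ℝ) ≤ ℓ (K - 2) := cast_le (by omega)
              have : (ℓ (K - 2) : ℝ) < dist v x := by
                have := dist_triangle x₀ v x
                linarith
              have : K - 2 < j + 1 := cast_lt_imp (this.trans_le hxj)
              omega
          have := annulusCount_le_add_card _ hext
          have h5 : #({k + 1, k + 2, K - 2, K - 1, K} : Finset ℕ) ≤ 5 := card_le_five
          omega
        · -- Case B: induction inside the box around `u` ("translate the set by `u`")
          have hQsmall : #(X.filter fun x => dist u x ≤ ℓ k) < 2 ^ r := by rw [← hQ]; omega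
          obtain ⟨v, hvX, hv, hcount⟩ := ih k X u huX hQsmall
          refine ⟨v, hvX, huv_far hv, ?_⟩
          have hx₀v : dist x₀ v ≤ ℓ (k + 2) + ℓ k :=
            (dist_triangle x₀ u v).trans (add_le_add huk hv)
          have hext : ∀ j, k < j → j ≤ K → AnnulusOccupied ℓ X v j →
              j ∈ ({k + 1, k + 2, k + 3, K - 3, K - 2, K - 1, K} : Finset ℕ) := by
            rintro j hkj hjK ⟨x, hx, hjx, hxj⟩
            simp only [mem_insert, mem_singleton]
            rcases dich x hx with hin | hout
            · -- inner point: `dist v x < ℓ_{k+4}`, so `j ≤ k + 3`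
              have h3 : (ℓ (k + 2) : ℝ) + ℓ (k + 2) ≤ ℓ (k + 3) := cast_two (k + 2)
              have h4 : (ℓ (k + 3) : ℝ) + ℓ (k + 3) ≤ ℓ (k + 4) := cast_two (k + 3)
              have hnn : (0 : ℝ) ≤ ℓ (k + 2) := Nat.cast_nonneg _
              have : dist v x < ℓ (k + 4) :=
                calc dist v x ≤ dist v x₀ + dist x₀ x := dist_triangle _ _ _
                  _ ≤ (ℓ (k + 2) + ℓ k) + ℓ (k + 2) := by
                      rw [dist_comm]; exact add_le_add hx₀v hin
                  _ < ℓ (k + 4) := by linarith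
              have : j < k + 4 := cast_lt_imp (hjx.trans_lt this)
              omega
            · -- outer point
              by_cases hkK : K - 1 ≤ k + 2
              · -- the outermost middle annulus is `K - 2` itself: `j ≥ k + 1 ≥ K - 3`
                omega
              · -- `k + 2 ≤ K - 2`: `dist v x > ℓ_{K-3}`, so `j ≥ K - 3`
                have hk2K2 : (ℓ (k + 2) : ℝ) ≤ ℓ (K - 2) := cast_le (by omega)
                have hkK4 : (ℓ k : ℝ) ≤ ℓ (K - 4) := cast_le (by omega)
                have hK4 : (ℓ (K - 4) : ℝ) + ℓ (K - 4) ≤ ℓ (K - 3) := by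
                  have := cast_two (K - 4)
                  rwa [show K - 4 + 1 = K - 3 by omega] at this
                have hK3 : (ℓ (K - 3) : ℝ) + ℓ (K - 3) ≤ ℓ (K - 2) := by
                  have := cast_two (K - 3)
                  rwa [show K - 3 + 1 = K - 2 by omega] at this
                have hK2 : (ℓ (K - 2) : ℝ) + ℓ (K - 2) ≤ ℓ (K - 1) := by
                  have := cast_two (K - 2)
                  rwa [show K - 2 + 1 = K - 1 by omega] at this
                have hK3pos : (1 : ℝ) ≤ ℓ (K - 3) := by
                  exact_mod_cast one_le_scale h1 h2 (show 1 ≤ K - 3 by omega)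
                have : (ℓ (K - 3) : ℝ) < dist v x := by
                  have := dist_triangle x₀ v x
                  linarith
                have : K - 3 < j + 1 := cast_lt_imp (this.trans_le hxj)
                omega
          have := annulusCount_le_add_card _ hext
          have h7 : #({k + 1, k + 2, k + 3, K - 3, K - 2, K - 1, K} : Finset ℕ) ≤ 7 :=
            (card_insert_le _ _).trans (Nat.succ_le_succ ((card_insert_le _ _).trans
              (Nat.succ_le_succ card_le_five)))
          omega

/-! ### The annular covering lemma -/

/-- **Annular covering lemma, covering form** (Aizenman–Duminil-Copin 2021, Lemma 4.2, in the
form in which it is used in the proof of Thm 1.3 (§4.1) and in §6.1, and in which the 2020 preprint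
states it): for a scale
sequence with `ℓ_1 ≥ 1` and `ℓ_{k+1} ≥ 2ℓ_k`, if a nonempty finite set `X` has fewer than `2^r`
points, then some `u ∈ X` has `M_u(X; ℓ, K) < 7r` (printed with `5r`; see the module docstring
for the constant). [cite: AizenmanDuminilCopinAnnals2021, arXiv:1912.07973 §4.1, Lemma 4.2] -/
theorem exists_annulusCount_lt_of_card_lt_two_pow {ℓ : ℕ → ℕ} (h1 : 1 ≤ ℓ 1)
    (h2 : ∀ k, 2 * ℓ k ≤ ℓ (k + 1)) (K : ℕ) {X : Finset α} (hX : X.Nonempty) {r : ℕ}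
    (hr : #X < 2 ^ r) : ∃ u ∈ X, annulusCount ℓ K X u < 7 * r := by
  classical
  obtain ⟨x₀, hx₀⟩ := hX
  have hr1 : 1 ≤ r := by
    rcases Nat.eq_zero_or_pos r with rfl | h
    · rw [pow_zero] at hr
      exact absurd (card_pos.2 ⟨x₀, hx₀⟩) (by omega)
    · exact h
  obtain ⟨u, hu, -, hcount⟩ := exists_annulusCount_lt_aux h1 h2 hr1 K X x₀ hx₀
    ((card_le_card (filter_subset _ X)).trans_lt hr)
  exact ⟨u, hu, hcount⟩

/-- **Annular covering lemma, printed shape** (Aizenman–Duminil-Copin 2021, Lemma 4.2: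
"`|𝒳| ≥ 2^{min{M_u(𝒳;𝓛,K)/5 : u ∈ 𝒳}}`", here with `⌊M_u/7⌋`, see the module docstring): for a
scale sequence with `ℓ_1 ≥ 1` and `ℓ_{k+1} ≥ 2ℓ_k` and a nonempty finite set `X`, some `u ∈ X`
satisfies `2^{⌊M_u(X; ℓ, K)/7⌋} ≤ |X|`. [cite: AizenmanDuminilCopinAnnals2021, arXiv:1912.07973 §4.1, Lemma 4.2] -/
theorem exists_two_pow_annulusCount_div_le_card {ℓ : ℕ → ℕ} (h1 : 1 ≤ ℓ 1)
    (h2 : ∀ k, 2 * ℓ k ≤ ℓ (k + 1)) (K : ℕ) {X : Finset α} (hX : X.Nonempty) :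
    ∃ u ∈ X, 2 ^ (annulusCount ℓ K X u / 7) ≤ #X := by
  have hcard : #X ≠ 0 := card_ne_zero.2 hX
  obtain ⟨u, hu, hlt⟩ := exists_annulusCount_lt_of_card_lt_two_pow h1 h2 K hX
    (Nat.lt_pow_succ_log_self Nat.one_lt_two #X)
  refine ⟨u, hu, (Nat.pow_le_pow_right Nat.two_pos ?_).trans (Nat.pow_log_le_self 2 hcard)⟩
  omega

end Literature.Probability.LatticeModels
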